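import Mathlib
import HarnessLib
import Literature.MathematicalPhysics.QuantumLattice.TorusCentredSampling

/-!
# Composed symbols `g(ω, u(p⃗))·κ(p⃗)` sampled at the CENTRED momenta: mixed lattice differences of the value and of a band increment,
# with an angular factor

Topic `MathematicalPhysics/QuantumLattice`; continues `TorusCentredSampling` (the centred sampling bound `norm_fwdDiff_iter₂_centred_le`)
and `HubbardUVSymbolBandIncrements` / `HubbardUVSymbolFibreSampling` (fibrewise envelopes `FibreEnvBound`, the Faà di Bruno–Leibniz
bound `norm_iteratedFDeriv_comp_fbPt_mul_le`, the band interpolation).  The scale-`0` sector multipliers of Benfatto–Giuliani–Mastropietro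
2006 (§2.5 (2.45)–(2.48)) are products `g(k₀, e_K(k⃗))·A(k⃗)` of a smooth radial cutoff on the frequency–band plane with an ANGULAR factor
`A` read at the centred momentum; for the first space moments of their kernels (§3 (3.2)–(3.8): telescoped over the frame pieces) one
needs, besides the value `g(ω, b(·))·A`, the increments `[g(ω, v + w) − g(ω, v)]·A = ∫₀¹ ∂_e g(ω, v + s w)·(w·A) ds`:

* **`norm_fwdDiff_iter₂_comp_fbPt_band_increment_mul_le`** — the band interpolation with a factor:
  `‖Δ^aΔ^b[g(ω,v+w)κ] − Δ^aΔ^b[g(ω,v)κ]‖ ≤ sup_s ‖Δ^aΔ^b[∂_{e₁}g(ω, v + s w)·(wκ)]‖` (any additive group of lattice points);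
* **`norm_fwdDiff_iter₂_comp_mul_centred_le`** — `‖Δ_{e_l}^aΔ_{e_{l'}}^b[g(ω,u(c⃗))·κ(c⃗)](k⃗)‖ ≤ (2π/L)ᵏ·C·E_σ(ω)·Σ_{j≤k} C(k,j)j!DʲW_{k-j}`
  (`a, b ≤ 2`, `l ≠ l'`, `8 < L`; `u, κ` smooth with global derivative bounds; the composed function vanishes near the zone boundary);
* **`norm_fwdDiff_iter₂_increment_mul_centred_le`** — the same for the increment, with `D` bounding `ṽ + s·w̃` for all `s ∈ [0,1]` and
  `W` bounding the derivatives of the product `w̃·κ̃`.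

Everything is proved; no definitions, no named facts.

## Sources

G. Benfatto, A. Giuliani, V. Mastropietro, Ann. Henri Poincaré 7 (2006) 809–898, §2.1 (2.36aa), §2.5 (2.45)–(2.48), §3 (3.2)–(3.8)
(`BenfattoGiulianiMastropietro2006`).
-/

noncomputable section

namespace Literature.MathematicalPhysics.QuantumLattice

open Real Finset Set Complex Literature.Probability.LatticeModels Literature.Analysis.Calculus
open scoped Nat

/-! ### §1 The band interpolation with a factor -/

section Increment

variable {X : Type*} [AddCommGroup X]

/-- **Band increment with a factor**: with `G_s(y) = g(ω, v(y) + s·w(y))·κ(y)` and `H_s(y) = ∂_{e₁}g(ω, v(y) + s·w(y))·(w(y)κ(y))`,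
`‖(Δ_{u₁})ᵃ(Δ_{u₂})ᵇ G_1(x) − (Δ_{u₁})ᵃ(Δ_{u₂})ᵇ G_0(x)‖ ≤ sup_{s ∈ [0,1)} ‖(Δ_{u₁})ᵃ(Δ_{u₂})ᵇ H_s(x)‖`.
[cite: BenfattoGiulianiMastropietro2006, §3 (3.2)–(3.8)] -/
theorem norm_fwdDiff_iter₂_comp_fbPt_band_increment_mul_le {g : FreqBand → ℂ} (hg : Differentiable ℝ g) (ω : ℝ) (v w κ : X → ℝ)
    (u₁ u₂ : X) (a b : ℕ) (x : X) {C : ℝ}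
    (hC : ∀ s ∈ Ico (0 : ℝ) 1,
      ‖(fwdDiff u₁)^[a] ((fwdDiff u₂)^[b] (fun y => fbDir g fbE1 (fbPt ω (v y + s * w y)) * ((w y * κ y : ℝ) : ℂ))) x‖ ≤ C) :
    ‖(fwdDiff u₁)^[a] ((fwdDiff u₂)^[b] (fun y => g (fbPt ω (v y + w y)) * ((κ y : ℝ) : ℂ))) x -
        (fwdDiff u₁)^[a] ((fwdDiff u₂)^[b] (fun y => g (fbPt ω (v y)) * ((κ y : ℝ) : ℂ))) x‖ ≤ C := by
  have h := norm_fwdDiff_iter₂_sub_le_of_family (F := fun s y => g (fbPt ω (v y + s * w y)) * ((κ y : ℝ) : ℂ))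
    (F' := fun s y => fbDir g fbE1 (fbPt ω (v y + s * w y)) * ((w y * κ y : ℝ) : ℂ))
    (fun s y => ((hasDerivAt_comp_fbPt_band hg ω (v y) (w y) s).mul_const ((κ y : ℝ) : ℂ)).congr_deriv (by push_cast; ring))
    u₁ u₂ a b x hC
  simpa only [one_mul, zero_mul, add_zero] using h

end Increment

/-! ### §2 The centred-sampled bounds -/

section Centred

variable {L : ℕ} [NeZero L]

/-- **Centred-sampled Leibniz–Faà di Bruno**: for `g` with a fibrewise envelope bound of order `k = a + b` (`a, b ≤ 2`), smooth `u, κ` on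
the Euclidean plane with `‖Dⁱu‖ ≤ Dⁱ` (`1 ≤ i ≤ k`), `‖Dⁱκ‖ ≤ Wᵢ` (`i ≤ k`), and the composed function vanishing near the zone boundary,
`‖Δ_{e_l}^aΔ_{e_{l'}}^b[y ↦ g(ω, u(c⃗_y))·κ(c⃗_y)](k⃗)‖ ≤ (2π/L)ᵏ·C·E_σ(ω)·Σ_{j≤k} C(k,j)·j!·Dʲ·W_{k-j}` (`l ≠ l'`, `8 < L`).
[cite: BenfattoGiulianiMastropietro2006, (2.36aa) and §3 (3.2)] -/
theorem norm_fwdDiff_iter₂_comp_mul_centred_le {Λ : ℝ} (hΛ : 0 < Λ) (hL : 8 < L) {g : FreqBand → ℂ} {a b : ℕ} (ha : a ≤ 2) (hb : b ≤ 2)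
    (hg : ContDiff ℝ (↑(a + b : ℕ)) g) {C σ : ℝ} (hG : FibreEnvBound Λ g (a + b) C σ)
    {u κ : EuclideanSpace ℝ (Fin 2) → ℝ} (hu : ContDiff ℝ (↑(a + b : ℕ)) u) (hκ : ContDiff ℝ (↑(a + b : ℕ)) κ)
    {D : ℝ} (hD : ∀ i, 1 ≤ i → i ≤ a + b → ∀ x, ‖iteratedFDeriv ℝ i u x‖ ≤ D ^ i)
    {W : ℕ → ℝ} (hW : ∀ i ≤ a + b, ∀ x, ‖iteratedFDeriv ℝ i κ x‖ ≤ W i) (ω : ℝ)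
    (hvan : ∀ p : Fin 2 → ℝ, (∃ l : Fin 2, Real.cos (p l) ≤ -Real.cos (4 * π / L)) →
      g (fbPt ω (u (WithLp.toLp 2 p))) * ((κ (WithLp.toLp 2 p) : ℝ) : ℂ) = 0)
    {l l' : Fin 2} (hll' : l ≠ l') (k : TorusSite 2 L) :
    ‖(fwdDiff (Pi.single l (1 : ZMod L) : TorusSite 2 L))^[a]
        ((fwdDiff (Pi.single l' (1 : ZMod L) : TorusSite 2 L))^[b]
          (fun y => g (fbPt ω (u (WithLp.toLp 2 (torusCentredMomentum L y)))) *
            ((κ (WithLp.toLp 2 (torusCentredMomentum L y)) : ℝ) : ℂ))) k‖ ≤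
      (2 * π / L) ^ (a + b) * (C * (2 / max (|ω| - σ) (Λ / 2)) *
        ∑ j ∈ Finset.range (a + b + 1), ((a + b).choose j : ℝ) * j ! * D ^ j * W (a + b - j)) := by
  have hC0 : 0 ≤ C := hG.nonneg hΛ
  have hE : 0 ≤ 2 / max (|ω| - σ) (Λ / 2) := div_nonneg zero_le_two (le_max_of_le_right (by positivity))
  set C' : ℝ := C * (2 / max (|ω| - σ) (Λ / 2)) with hC'
  have hK : ∀ x, ‖iteratedFDeriv ℝ (a + b) (fun p => g (fbPt ω (u p)) * ((κ p : ℝ) : ℂ)) x‖ ≤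
      ∑ j ∈ Finset.range (a + b + 1), ((a + b).choose j : ℝ) * j ! * D ^ j * W (a + b - j) * C' := by
    intro x
    have h := norm_iteratedFDeriv_comp_fbPt_mul_le hg hu hκ ω x (C' := C')
      (fun i hi => by simpa only [fbPt_apply_zero] using hG i hi (fbPt ω (u x))) (fun i hi1 hi2 => hD i hi1 hi2 x)
    refine h.trans (Finset.sum_le_sum fun j hj => ?_)
    have hjk : j ≤ a + b := Nat.lt_succ_iff.1 (Finset.mem_range.1 hj)
    have hDj : 0 ≤ D ^ j := by
      rcases Nat.eq_zero_or_pos j with rfl | hj0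
      · simp
      · exact le_trans (norm_nonneg _) (hD j hj0 hjk x)
    calc ((a + b).choose j : ℝ) * (j ! * C' * D ^ j) * ‖iteratedFDeriv ℝ (a + b - j) κ x‖
        ≤ ((a + b).choose j : ℝ) * (j ! * C' * D ^ j) * W (a + b - j) :=
          mul_le_mul_of_nonneg_left (hW _ (Nat.sub_le _ _) x) (by positivity)
      _ = ((a + b).choose j : ℝ) * j ! * D ^ j * W (a + b - j) * C' := by ring
  have hcd : ContDiff ℝ (↑(a + b : ℕ)) (fun p => g (fbPt ω (u p)) * ((κ p : ℝ) : ℂ)) :=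
    (hg.comp (contDiff_fbPt_comp hu ω)).mul (Complex.ofRealCLM.contDiff.comp hκ)
  have h := norm_fwdDiff_iter₂_centred_le hL (fun p => g (fbPt ω (u p)) * ((κ p : ℝ) : ℂ)) hvan ha hb hcd hK hll' k
  refine h.trans (le_of_eq ?_)
  rw [Finset.sum_mul, Finset.mul_sum, Finset.mul_sum]
  exact Finset.sum_congr rfl fun j _ => by ring

/-- **Centred-sampled band increment with a factor**: for lattice data `v = ṽ∘c⃗`, `w = w̃∘c⃗`, `κ = κ̃∘c⃗` with `‖Dⁱ(ṽ + s·w̃)‖ ≤ Dⁱ`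
(`1 ≤ i ≤ k`, all `s ∈ [0,1]`) and `‖Dⁱ(w̃·κ̃)‖ ≤ Wᵢ` (`i ≤ k`), `g ∈ C^{k+1}` whose band derivative `∂_{e₁}g` has a fibrewise envelope bound
of order `k` with constant `C`, and the integrand vanishing near the zone boundary for every `s`:
`‖Δ^aΔ^b[g(ω, v + w)·κ](k⃗) − Δ^aΔ^b[g(ω, v)·κ](k⃗)‖ ≤ (2π/L)ᵏ·C·E_σ(ω)·Σ_{j≤k} C(k,j)·j!·Dʲ·W_{k-j}`.
[cite: BenfattoGiulianiMastropietro2006, §3 (3.2)–(3.8)] -/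
theorem norm_fwdDiff_iter₂_increment_mul_centred_le {Λ : ℝ} (hΛ : 0 < Λ) (hL : 8 < L) {g : FreqBand → ℂ} {a b : ℕ}
    (ha : a ≤ 2) (hb : b ≤ 2) (hg : ContDiff ℝ (((a + b : ℕ) : ℕ∞) + 1) g) {C σ : ℝ}
    (hG : FibreEnvBound Λ (fbDir g fbE1) (a + b) C σ)
    {v w κ : EuclideanSpace ℝ (Fin 2) → ℝ} (hv : ContDiff ℝ (↑(a + b : ℕ)) v) (hw : ContDiff ℝ (↑(a + b : ℕ)) w)
    (hκ : ContDiff ℝ (↑(a + b : ℕ)) κ)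
    {D : ℝ} (hD : ∀ s ∈ Icc (0 : ℝ) 1, ∀ i, 1 ≤ i → i ≤ a + b → ∀ x, ‖iteratedFDeriv ℝ i (fun x => v x + s * w x) x‖ ≤ D ^ i)
    {W : ℕ → ℝ} (hW : ∀ i ≤ a + b, ∀ x, ‖iteratedFDeriv ℝ i (fun x => w x * κ x) x‖ ≤ W i) (ω : ℝ)
    (hvan : ∀ s ∈ Ico (0 : ℝ) 1, ∀ p : Fin 2 → ℝ, (∃ l : Fin 2, Real.cos (p l) ≤ -Real.cos (4 * π / L)) →
      fbDir g fbE1 (fbPt ω (v (WithLp.toLp 2 p) + s * w (WithLp.toLp 2 p))) *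
        ((w (WithLp.toLp 2 p) * κ (WithLp.toLp 2 p) : ℝ) : ℂ) = 0)
    {l l' : Fin 2} (hll' : l ≠ l') (k : TorusSite 2 L) :
    ‖(fwdDiff (Pi.single l (1 : ZMod L) : TorusSite 2 L))^[a]
          ((fwdDiff (Pi.single l' (1 : ZMod L) : TorusSite 2 L))^[b]
            (fun y => g (fbPt ω (v (WithLp.toLp 2 (torusCentredMomentum L y)) + w (WithLp.toLp 2 (torusCentredMomentum L y)))) *
              ((κ (WithLp.toLp 2 (torusCentredMomentum L y)) : ℝ) : ℂ))) k -
        (fwdDiff (Pi.single l (1 : ZMod L) : TorusSite 2 L))^[a]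
          ((fwdDiff (Pi.single l' (1 : ZMod L) : TorusSite 2 L))^[b]
            (fun y => g (fbPt ω (v (WithLp.toLp 2 (torusCentredMomentum L y)))) *
              ((κ (WithLp.toLp 2 (torusCentredMomentum L y)) : ℝ) : ℂ))) k‖ ≤
      (2 * π / L) ^ (a + b) * (C * (2 / max (|ω| - σ) (Λ / 2)) *
        ∑ j ∈ Finset.range (a + b + 1), ((a + b).choose j : ℝ) * j ! * D ^ j * W (a + b - j)) := by
  have hdg : Differentiable ℝ g := hg.differentiable (by exact_mod_cast Nat.succ_ne_zero (a + b))
  have hg1 : ContDiff ℝ (↑(a + b : ℕ)) (fbDir g fbE1) := contDiff_fbDir hg fbE1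
  refine norm_fwdDiff_iter₂_comp_fbPt_band_increment_mul_le hdg ω (fun y => v (WithLp.toLp 2 (torusCentredMomentum L y)))
    (fun y => w (WithLp.toLp 2 (torusCentredMomentum L y))) (fun y => κ (WithLp.toLp 2 (torusCentredMomentum L y))) _ _ a b k
    (fun s hs => ?_)
  have h := norm_fwdDiff_iter₂_comp_mul_centred_le (L := L) hΛ hL ha hb hg1 hG (u := fun x => v x + s * w x) (κ := fun x => w x * κ x)
    (hv.add (contDiff_const.mul hw)) (hw.mul hκ) (hD s (Ico_subset_Icc_self hs)) hW ω (hvan s hs) hll' k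
  exact h

end Centred

end Literature.MathematicalPhysics.QuantumLattice

end
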